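import Mathlib.NumberTheory.Chebyshev
import Mathlib.NumberTheory.ArithmeticFunction.Misc
import Mathlib.Analysis.Complex.ExponentialBounds
import Mathlib.Analysis.SpecialFunctions.Log.Deriv
import Literature.NumberTheory.LFunctions.ThetaSmallRange
import Literature.NumberTheory.LFunctions.PsiThetaSmall
import Literature.NumberTheory.LFunctions.SchoenfeldPsiSmall
import HarnessLib

/-!
# Explicit Chebyshev–Sylvester bounds: `0.9392 x − 9 √x ≤ ψ(x) ≤ 1.0722 x + 7 √x` for all `x ≥ 0`

Topic `Literature/NumberTheory/LFunctions` (prime distribution, elementary). Everything here is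
PROVED (no named facts). `ψ`, `θ` are Mathlib's `Chebyshev.psi`, `Chebyshev.theta`.

## Main results

* `Literature.NumberTheory.LFunctions.psi_le_sylvester` : `ψ(x) ≤ 1.0722 x + 7 √x` (`x ≥ 0`);
* `Literature.NumberTheory.LFunctions.sylvester_le_psi` : `0.9392 x − 9 √x ≤ ψ(x)` (`x ≥ 0`);
* `Literature.NumberTheory.LFunctions.theta_bounds_sylvester` : the same for `θ` up to Mathlib's
  `ψ − θ ≤ 2 √x log x` (`x ≥ 1`).

The ratio of the two slopes is `1.0722/0.9392 = 1.1416…`, so these bounds give primes in every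
interval `(x, 1.15 x]` for `x` large (made fully explicit, `x ≥ 33`, in
`ChebyshevSylvesterPrimeWindows.lean`); Mathlib's Chebyshev file has the slopes `log 2 − ε` and
`log 4 + ε` (ratio `2`), i.e. Bertrand-type windows only.

## The argument (Chebyshev 1852, Sylvester 1881/1892; exposition and the optimal constants of each
scheme: Gantumur 2025)

With `T(x) = ∑_{n ≤ x} log n = log ⌊x⌋!` and a finitely supported `ν` with `∑ ν(n)/n = 0`, the sum
`V(x) = ∑_n ν(n) T(x/n)` equals `∑_{k ≤ x} Λ(k) E(x/k)` with `E(y) = ∑_n ν(n) ⌊y/n⌋` periodic, and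
`V(x) = A(ν) x + O(log x)`, `A(ν) = −∑ ν(n) log n/n` (Gantumur, Thm 3.1). We use Sylvester's 1892
scheme `ν₆ = [1,6,70; 2,3,5,7,210]` (`Sylvester.E`, period `210`, `0 ≤ E ≤ 2`, `E = 1` on `[1,10)`,
`A(ν₆) = (34 log 2)/105 + (6 log 3)/35 + (4 log 5)/21 + (2 log 7)/15 = 0.97879…`, `Sylvester.A`),
and the two pointwise comparisons (read off the graph of `E`, Gantumur Remarks 3.3–3.4, §6)
`𝟙[1,10) + 𝟙[11,15) ≤ E ≤ 𝟙[1,∞) + 𝟙[13,14) + 𝟙[19,20) + 𝟙[73,∞)` (`Sylvester.wU_le_E`,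
`Sylvester.E_le_wL`, by `decide` on one period), which give
`ψ(x) − ψ(x/10) + ψ(x/11) − ψ(x/15) ≤ V(x) ≤ ψ(x) + ψ(x/13) − ψ(x/14) + ψ(x/19) − ψ(x/20) + ψ(x/73)`
(`Sylvester.psi_comb_le_V`, `Sylvester.V_le_psi_comb`). Sylvester's iteration (Gantumur §5) is run
to its fixed point at once: with `b = 1.0722 ≥ A + b/10 − a/11 + b/15` and
`a = 0.9392 ≤ A − b/13 + a/14 − b/19 + a/20 − b/73`, the bounds `a y − 9 √y ≤ ψ(y) ≤ b y + 7 √y`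
propagate from `[0, x/10]` to `x` (`Sylvester.step_upper`, `Sylvester.step_lower`; the error
recursion contracts in the class `√x` for this choice of terms), so a strong induction on `⌊x⌋`
proves them for all `x ≥ 0` once they are known on a base range. The base range `[0, 8886113]`
is read off the tree's kernel-certified tables: `ψ(x) ≤ 1.04 x` for `x ≤ 10⁴`
(`SchoenfeldBound.psi_le_of_le_ten_thousand`), Schoenfeld's `|θ(x) − x| ≤ √x log² x/(8π)` on
`[599, 8886113]` (`abs_theta_sub_le_smallRange`) and Nicolas's `ψ − θ ≤ √x + (4/3) x^{1/3}` below
`2³²` (`psi_sub_theta_le_of_lt_two_pow_32`), together with Mathlib's `Chebyshev.psi_ge'` below `599`.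

Design notes. (1) The optimal constants of `ν₆` under Sylvester's procedure are `a = 0.944462`,
`b = 1.055800` (Gantumur §6, ratio `1.1179`), but the corresponding recursion has too many terms for a
`√x` error class (its error recursion only contracts in `x^{0.8}`), which would make the bounds
useless below astronomically large `x`; the reduced term set used here is the best one whose error
recursion contracts at exponent `1/2` (ratio `1.1414`). (2) `Sylvester.T`, `Sylvester.V` are indexed by
`N = ⌊x⌋` (`⌊⌊x⌋/d⌋ = ⌊x/d⌋`), and `V = ∑ Λ(k) E(⌊N/k⌋)` is Mathlib's
`ArithmeticFunction.sum_Ioc_mul_zeta_eq_sum` applied to `Λ * ζ = log`. (3) Stirling is used only in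
the weak form `|T(y) − (y log y − y)| ≤ log y + 2` (`Sylvester.abs_T_floor_sub_le`, from
`log(1 + 1/n) ∈ [1/(n+1), 1/n]`).

## References

* J. J. Sylvester, *On arithmetical series*, Messenger of Math. 21 (1892), 1–19, 87–120 (the scheme
  `[1,6,70;2,3,5,7,210]` and the iterative refinement). [Sylvester1892]
* J. J. Sylvester, *On Tchebycheff's theory of the totality of the prime numbers comprised within
  given limits*, Amer. J. Math. 4 (1881), 230–247. [Sylvester1881]
* P. L. Chebyshev, *Mémoire sur les nombres premiers*, J. Math. Pures Appl. 17 (1852), 366–390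
  (the framework, scheme `[1,30;2,3,5]`). [Chebyshev1852]
* T. Gantumur, *An expository review of the Chebyshev–Sylvester method in prime number theory*,
  arXiv:2512.02466 (2025): Lemma 2.3, Thm 3.1, §4 (`ν₆`: period 210, `0 ≤ E ≤ 2`, `A(ν₆) = 0.9787…`),
  §§5–6 (the iteration; `a = 0.944462`, `b = 1.055800` optimal for `ν₆`). [Gantumur2025]
-/

noncomputable section

namespace Literature.NumberTheory.LFunctions

namespace Sylvester

open Nat hiding log
open Finset Real
open ArithmeticFunction hiding log id
open scoped Chebyshev

/-! ### The scheme `ν₆ = [1,6,70; 2,3,5,7,210]` and its step function `E` -/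

/-- Sylvester's step function for the scheme `ν₆ = δ₁ − δ₂ − δ₃ − δ₅ + δ₆ − δ₇ + δ₇₀ − δ₂₁₀`, on the
integers: `E(r) = r − ⌊r/2⌋ − ⌊r/3⌋ − ⌊r/5⌋ + ⌊r/6⌋ − ⌊r/7⌋ + ⌊r/70⌋ − ⌊r/210⌋`.
[cite: Sylvester1892, pp. 87–120 (scheme [1,6,70;2,3,5,7,210])] -/
def E (r : ℕ) : ℤ :=
  (r : ℤ) - (r / 2 : ℕ) - (r / 3 : ℕ) - (r / 5 : ℕ) + (r / 6 : ℕ) - (r / 7 : ℕ) + (r / 70 : ℕ) - (r / 210 : ℕ)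

/-- `E` has period `210` (the cancellation condition `∑ ν(n)/n = 0`). [cite: Gantumur2025, §4] -/
theorem E_add_period (r : ℕ) : E (r + 210) = E r := by
  unfold E; push_cast; omega

/-- `E` reduced modulo the period. [cite: Gantumur2025, §4] -/
theorem E_mod (r : ℕ) : E r = E (r % 210) := by
  conv_lhs => rw [← Nat.mod_add_div r 210]
  generalize r / 210 = q
  induction q with
  | zero => simp
  | succ q ih => rw [Nat.mul_succ, ← add_assoc, E_add_period, ih]

/-- `0 ≤ E ≤ 2` everywhere. [cite: Gantumur2025, §4 ("0 ≤ E(x) ≤ 2 for all x" for ν₆)] -/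
theorem E_nonneg_le_two (r : ℕ) : 0 ≤ E r ∧ E r ≤ 2 := by
  rw [E_mod]
  have h : r % 210 < 210 := Nat.mod_lt _ (by norm_num)
  revert h
  generalize r % 210 = s
  intro h
  interval_cases s <;> decide

/-- The upper comparison weight `w_U = 𝟙[1,10) + 𝟙[11,15)` lies below `E`.
[cite: Gantumur2025, §6 (upper bound for ν₆)] -/
theorem wU_le_E (r : ℕ) :
    ((if 1 ≤ r then 1 else 0) - (if 10 ≤ r then 1 else 0) + (if 11 ≤ r then 1 else 0)
      - (if 15 ≤ r then 1 else 0) : ℤ) ≤ E r := by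
  rcases lt_or_ge r 15 with h | h
  · interval_cases r <;> decide
  · have h1 : 1 ≤ r := by omega
    have h2 : 10 ≤ r := by omega
    have h3 : 11 ≤ r := by omega
    simp only [h1, h2, h3, h, if_true]
    linarith [(E_nonneg_le_two r).1]

/-- The lower comparison weight `w_L = 𝟙[1,∞) + 𝟙[13,14) + 𝟙[19,20) + 𝟙[73,∞)` lies above `E`.
[cite: Gantumur2025, §6 (lower bound for ν₆)] -/
theorem E_le_wL (r : ℕ) :
    E r ≤ ((if 1 ≤ r then 1 else 0) + (if 13 ≤ r then 1 else 0) - (if 14 ≤ r then 1 else 0)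
      + (if 19 ≤ r then 1 else 0) - (if 20 ≤ r then 1 else 0) + (if 73 ≤ r then 1 else 0) : ℤ) := by
  rcases lt_or_ge r 73 with h | h
  · interval_cases r <;> decide
  · have h1 : 1 ≤ r := by omega
    have h2 : 13 ≤ r := by omega
    have h3 : 14 ≤ r := by omega
    have h4 : 19 ≤ r := by omega
    have h5 : 20 ≤ r := by omega
    simp only [h1, h2, h3, h4, h5, h, if_true]
    linarith [(E_nonneg_le_two r).2]

/-! ### `T(x) = log ⌊x⌋!`, the identity `T(N/d) = ∑_k Λ(k) ⌊N/(kd)⌋`, and `V = ∑_k Λ(k) E(⌊N/k⌋)` -/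

/-- `T(N) = ∑_{m ≤ N} log m = log N!`. [cite: Gantumur2025, §2 (2.13)] -/
def T (N : ℕ) : ℝ := ∑ m ∈ Ioc 0 N, Real.log m

/-- `T(N) = ∑_{k ≤ N} Λ(k) ⌊N/k⌋` (from `log = Λ * ζ`). [cite: Gantumur2025, Lemma 2.3 and (2.15)] -/
theorem T_eq_sum (N : ℕ) : T N = ∑ k ∈ Ioc 0 N, Λ k * ((N / k : ℕ) : ℝ) := by
  rw [T, ← ArithmeticFunction.sum_Ioc_mul_zeta_eq_sum, ArithmeticFunction.vonMangoldt_mul_zeta]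
  refine Finset.sum_congr rfl fun m _ => ?_
  rw [ArithmeticFunction.log_apply]

/-- `T(⌊N/d⌋) = ∑_{k ≤ N} Λ(k) ⌊⌊N/k⌋/d⌋`. [cite: Gantumur2025, §3 (3.3)] -/
theorem T_div (N : ℕ) {d : ℕ} (hd : 0 < d) :
    T (N / d) = ∑ k ∈ Ioc 0 N, Λ k * ((N / k / d : ℕ) : ℝ) := by
  rw [T_eq_sum]
  have hsub : Ioc 0 (N / d) ⊆ Ioc 0 N := by
    intro k hk
    simp only [mem_Ioc] at hk ⊢
    exact ⟨hk.1, hk.2.trans (Nat.div_le_self _ _)⟩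
  rw [← Finset.sum_subset hsub]
  · refine Finset.sum_congr rfl fun k _ => ?_
    rw [Nat.div_div_eq_div_mul, Nat.div_div_eq_div_mul, Nat.mul_comm d k]
  · intro k hk hk'
    simp only [mem_Ioc, not_and, not_le] at hk hk'
    have hlt : N / d < k := hk' hk.1
    rw [Nat.div_lt_iff_lt_mul hd] at hlt
    rw [Nat.div_div_eq_div_mul, Nat.div_eq_of_lt hlt]
    simp

/-- Sylvester's `V(x) = T(x) − T(x/2) − T(x/3) − T(x/5) + T(x/6) − T(x/7) + T(x/70) − T(x/210)` for the
scheme `ν₆`, as a function of `N = ⌊x⌋` (note `⌊⌊x⌋/d⌋ = ⌊x/d⌋`).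
[cite: Sylvester1892, pp. 87–120 (scheme [1,6,70;2,3,5,7,210])] -/
def V (N : ℕ) : ℝ :=
  T N - T (N / 2) - T (N / 3) - T (N / 5) + T (N / 6) - T (N / 7) + T (N / 70) - T (N / 210)

/-- `V = ∑_{k ≤ N} Λ(k) E(⌊N/k⌋)`. [cite: Gantumur2025, §3 (3.3)] -/
theorem V_eq_sum (N : ℕ) : V N = ∑ k ∈ Ioc 0 N, Λ k * (E (N / k) : ℝ) := by
  have h1 : T N = ∑ k ∈ Ioc 0 N, Λ k * ((N / k / 1 : ℕ) : ℝ) := by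
    rw [← T_div N Nat.one_pos, Nat.div_one]
  rw [V, h1, T_div N (by norm_num : 0 < 2), T_div N (by norm_num : 0 < 3), T_div N (by norm_num : 0 < 5),
    T_div N (by norm_num : 0 < 6), T_div N (by norm_num : 0 < 7), T_div N (by norm_num : 0 < 70),
    T_div N (by norm_num : 0 < 210)]
  simp only [← Finset.sum_sub_distrib, ← Finset.sum_add_distrib, ← mul_sub, ← mul_add]
  refine Finset.sum_congr rfl fun k _ => ?_
  simp only [E, Nat.div_one, Int.cast_sub, Int.cast_add, Int.cast_natCast]

/-! ### `ψ(x/a)` as a weighted sum over `k ≤ ⌊x⌋`, and the two comparison inequalities -/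

/-- `ψ(x/a) = ∑_{k ≤ ⌊x⌋} Λ(k) 𝟙[a ≤ ⌊⌊x⌋/k⌋]` for `a ≥ 1`. [cite: Gantumur2025, Remark 3.3] -/
theorem psi_div_eq_sum (x : ℝ) {a : ℕ} (ha : 0 < a) :
    ψ (x / a) = ∑ k ∈ Ioc 0 ⌊x⌋₊, Λ k * ((if a ≤ ⌊x⌋₊ / k then 1 else 0 : ℤ) : ℝ) := by
  rw [Chebyshev.psi, Nat.floor_div_natCast]
  set N := ⌊x⌋₊
  have hfilter : (Ioc 0 N).filter (fun k => a ≤ N / k) = Ioc 0 (N / a) := by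
    ext k
    simp only [mem_filter, mem_Ioc]
    constructor
    · rintro ⟨⟨hk0, -⟩, hk⟩
      refine ⟨hk0, ?_⟩
      rw [Nat.le_div_iff_mul_le ha]
      rw [Nat.le_div_iff_mul_le hk0] at hk
      rwa [mul_comm] at hk
    · rintro ⟨hk0, hk⟩
      rw [Nat.le_div_iff_mul_le ha] at hk
      refine ⟨⟨hk0, le_trans (Nat.le_mul_of_pos_right k ha) hk⟩, ?_⟩
      rw [Nat.le_div_iff_mul_le hk0, mul_comm]
      exact hk
  rw [← hfilter, Finset.sum_filter]
  refine Finset.sum_congr rfl fun k _ => ?_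
  split_ifs <;> simp

/-- **Upper comparison** (Sylvester): `ψ(x) − ψ(x/10) + ψ(x/11) − ψ(x/15) ≤ V(x)`, because
`𝟙[1,10) + 𝟙[11,15) ≤ E` pointwise and `Λ ≥ 0`. [cite: Gantumur2025, §6 (bounds for ν₆)] -/
theorem psi_comb_le_V (x : ℝ) :
    ψ x - ψ (x / 10) + ψ (x / 11) - ψ (x / 15) ≤ V ⌊x⌋₊ := by
  have h1 := psi_div_eq_sum x Nat.one_pos
  rw [Nat.cast_one, div_one] at h1
  have h10 := psi_div_eq_sum x (by norm_num : 0 < 10)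
  have h11 := psi_div_eq_sum x (by norm_num : 0 < 11)
  have h15 := psi_div_eq_sum x (by norm_num : 0 < 15)
  simp only [Nat.cast_ofNat] at h10 h11 h15
  rw [h1, h10, h11, h15, V_eq_sum]
  push_cast
  simp only [← Finset.sum_sub_distrib, ← Finset.sum_add_distrib, ← mul_sub, ← mul_add]
  refine Finset.sum_le_sum fun k _ => mul_le_mul_of_nonneg_left ?_ vonMangoldt_nonneg
  exact_mod_cast wU_le_E (⌊x⌋₊ / k)

/-- **Lower comparison** (Sylvester): `V(x) ≤ ψ(x) + ψ(x/13) − ψ(x/14) + ψ(x/19) − ψ(x/20) + ψ(x/73)`,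
because `E ≤ 𝟙[1,∞) + 𝟙[13,14) + 𝟙[19,20) + 𝟙[73,∞)` pointwise. [cite: Gantumur2025, §6 (bounds for ν₆)] -/
theorem V_le_psi_comb (x : ℝ) :
    V ⌊x⌋₊ ≤ ψ x + ψ (x / 13) - ψ (x / 14) + ψ (x / 19) - ψ (x / 20) + ψ (x / 73) := by
  have h1 := psi_div_eq_sum x Nat.one_pos
  rw [Nat.cast_one, div_one] at h1
  have h13 := psi_div_eq_sum x (by norm_num : 0 < 13)
  have h14 := psi_div_eq_sum x (by norm_num : 0 < 14)
  have h19 := psi_div_eq_sum x (by norm_num : 0 < 19)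
  have h20 := psi_div_eq_sum x (by norm_num : 0 < 20)
  have h73 := psi_div_eq_sum x (by norm_num : 0 < 73)
  simp only [Nat.cast_ofNat] at h13 h14 h19 h20 h73
  rw [h1, h13, h14, h19, h20, h73, V_eq_sum]
  push_cast
  simp only [← Finset.sum_sub_distrib, ← Finset.sum_add_distrib, ← mul_sub, ← mul_add]
  refine Finset.sum_le_sum fun k _ => mul_le_mul_of_nonneg_left ?_ vonMangoldt_nonneg
  exact_mod_cast E_le_wL (⌊x⌋₊ / k)

/-! ### Stirling-type bounds for `T` -/

/-- `T(N+1) = T(N) + log(N+1)`. [folklore] -/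
theorem T_succ (N : ℕ) : T (N + 1) = T N + Real.log ((N : ℝ) + 1) := by
  rw [T, T, Finset.sum_Ioc_succ_top (Nat.zero_le N)]
  push_cast
  ring

/-- `N log N − N + 1 ≤ T(N)` for `N ≥ 1` (comparison with `∫ log`). [cite: Gantumur2025, §2 (2.13)] -/
theorem T_ge {N : ℕ} (hN : 1 ≤ N) : (N : ℝ) * Real.log N - N + 1 ≤ T N := by
  induction N, hN using Nat.le_induction with
  | base => simp [T]
  | succ n hn ih =>
    rw [T_succ]
    have hn0 : (0 : ℝ) < n := by exact_mod_cast hn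
    have hn1 : (0 : ℝ) < n + 1 := by linarith
    -- `n (log(n+1) − log n) ≤ 1`
    have hlog : Real.log ((n + 1) / n) ≤ (n + 1) / n - 1 := Real.log_le_sub_one_of_pos (by positivity)
    rw [Real.log_div hn1.ne' hn0.ne'] at hlog
    have h1 : (n : ℝ) * (Real.log (n + 1) - Real.log n) ≤ 1 := by
      have := mul_le_mul_of_nonneg_left hlog hn0.le
      have e : (n : ℝ) * ((n + 1) / n - 1) = 1 := by field_simp; ring
      linarith
    push_cast
    nlinarith

/-- `T(N) ≤ N log N − N + 1 + log N` for `N ≥ 1`. [cite: Gantumur2025, §2 (2.13)] -/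
theorem T_le {N : ℕ} (hN : 1 ≤ N) : T N ≤ (N : ℝ) * Real.log N - N + 1 + Real.log N := by
  induction N, hN using Nat.le_induction with
  | base => simp [T]
  | succ n hn ih =>
    rw [T_succ]
    have hn0 : (0 : ℝ) < n := by exact_mod_cast hn
    have hn1 : (0 : ℝ) < n + 1 := by linarith
    -- `1 ≤ (n+1) (log(n+1) − log n)`
    have hlog : 1 - ((n + 1 : ℝ) / n)⁻¹ ≤ Real.log ((n + 1) / n) :=
      Real.one_sub_inv_le_log_of_pos (by positivity)
    rw [Real.log_div hn1.ne' hn0.ne', inv_div] at hlog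
    have h1 : 1 ≤ ((n : ℝ) + 1) * (Real.log (n + 1) - Real.log n) := by
      have := mul_le_mul_of_nonneg_left hlog hn1.le
      have e : ((n : ℝ) + 1) * (1 - n / (n + 1)) = 1 := by field_simp; ring
      linarith
    push_cast
    nlinarith

/-- `|T(⌊y⌋) − (y log y − y)| ≤ log y + 2` for `y ≥ 1`. [cite: Gantumur2025, §2 (2.13) (`T(x) = x ln x − x + O(ln x)`)] -/
theorem abs_T_floor_sub_le {y : ℝ} (hy : 1 ≤ y) :
    |T ⌊y⌋₊ - (y * Real.log y - y)| ≤ Real.log y + 2 := by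
  set N := ⌊y⌋₊ with hN
  have hN1 : 1 ≤ N := Nat.le_floor (by simpa using hy)
  have hy0 : 0 < y := by linarith
  have hNy : (N : ℝ) ≤ y := Nat.floor_le hy0.le
  have hyN : y < N + 1 := Nat.lt_floor_add_one y
  have hN0 : (0 : ℝ) < N := by exact_mod_cast hN1
  have hlogy : 0 ≤ Real.log y := Real.log_nonneg hy
  have hlogN : Real.log N ≤ Real.log y := Real.log_le_log hN0 hNy
  have hlogN0 : 0 ≤ Real.log (N : ℝ) := Real.log_nonneg (by exact_mod_cast hN1)
  have h1 := T_ge hN1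
  have h2 := T_le hN1
  -- `y log y − y ≤ N log N − N + log y`
  have hlog : Real.log (y / N) ≤ y / N - 1 := Real.log_le_sub_one_of_pos (by positivity)
  rw [Real.log_div hy0.ne' hN0.ne'] at hlog
  have h3 : (N : ℝ) * (Real.log y - Real.log N) ≤ y - N := by
    have := mul_le_mul_of_nonneg_left hlog hN0.le
    have e : (N : ℝ) * (y / N - 1) = y - N := by field_simp
    linarith
  have h4 : y * Real.log y - y ≤ N * Real.log N - N + Real.log y := by
    have : (y - N) * Real.log y ≤ 1 * Real.log y := by
      apply mul_le_mul_of_nonneg_right _ hlogy; linarith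
    nlinarith
  -- `N log N − N ≤ y log y − y + 1`
  have h5 : (N : ℝ) * Real.log N - N ≤ y * Real.log y - y + 1 := by
    have : 0 ≤ (y - N) * Real.log y := mul_nonneg (by linarith) hlogy
    nlinarith
  rw [abs_le]
  constructor <;> linarith

/-- `|T(⌊⌊x⌋/d⌋) − ((x/d) log(x/d) − x/d)| ≤ log x + 2` for `1 ≤ d ≤ x`. [cite: Gantumur2025, Thm 3.1 (a), proof] -/
theorem abs_T_div_sub_le {x : ℝ} {d : ℕ} (hd : 1 ≤ d) (hdx : (d : ℝ) ≤ x) :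
    |T (⌊x⌋₊ / d) - (x / d * Real.log (x / d) - x / d)| ≤ Real.log x + 2 := by
  have hd0 : (0 : ℝ) < d := by exact_mod_cast hd
  have hxd : 1 ≤ x / d := by rwa [le_div_iff₀ hd0, one_mul]
  have h := abs_T_floor_sub_le hxd
  rw [Nat.floor_div_natCast] at h
  have hlog : Real.log (x / d) ≤ Real.log x :=
    Real.log_le_log (by positivity) (div_le_self (by linarith) (by exact_mod_cast hd))
  linarith [h]

/-- The Chebyshev–Sylvester constant of the scheme `ν₆`:
`A(ν₆) = −∑ ν(n) log n / n = (34/105) log 2 + (6/35) log 3 + (4/21) log 5 + (2/15) log 7 = 0.97879…`.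
[cite: Gantumur2025, §4 (`A(ν₆) = 0.9787…`)] -/
def A : ℝ := 34 / 105 * Real.log 2 + 6 / 35 * Real.log 3 + 4 / 21 * Real.log 5 + 2 / 15 * Real.log 7

/-- **`V(x) = A x + O(log x)`, explicitly: `|V(⌊x⌋) − A x| ≤ 8 log x + 16` for `x ≥ 210`.**
[cite: Gantumur2025, Thm 3.1 (a)] -/
theorem abs_V_sub_le {x : ℝ} (hx : 210 ≤ x) : |V ⌊x⌋₊ - A * x| ≤ 8 * Real.log x + 16 := by
  have hx0 : 0 < x := by linarith
  have e1 := abs_T_div_sub_le (x := x) (d := 1) le_rfl (by norm_num; linarith)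
  have e2 := abs_T_div_sub_le (x := x) (d := 2) (by norm_num) (by norm_num; linarith)
  have e3 := abs_T_div_sub_le (x := x) (d := 3) (by norm_num) (by norm_num; linarith)
  have e5 := abs_T_div_sub_le (x := x) (d := 5) (by norm_num) (by norm_num; linarith)
  have e6 := abs_T_div_sub_le (x := x) (d := 6) (by norm_num) (by norm_num; linarith)
  have e7 := abs_T_div_sub_le (x := x) (d := 7) (by norm_num) (by norm_num; linarith)
  have e70 := abs_T_div_sub_le (x := x) (d := 70) (by norm_num) (by norm_num; linarith)
  have e210 := abs_T_div_sub_le (x := x) (d := 210) (by norm_num) (by norm_num; linarith)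
  rw [Nat.div_one] at e1
  simp only [Nat.cast_one, div_one, Nat.cast_ofNat] at e1 e2 e3 e5 e6 e7 e70 e210
  -- the main terms add up to `A x`
  have l2 : Real.log (x / 2) = Real.log x - Real.log 2 := Real.log_div hx0.ne' (by norm_num)
  have l3 : Real.log (x / 3) = Real.log x - Real.log 3 := Real.log_div hx0.ne' (by norm_num)
  have l5 : Real.log (x / 5) = Real.log x - Real.log 5 := Real.log_div hx0.ne' (by norm_num)
  have l6 : Real.log (x / 6) = Real.log x - (Real.log 2 + Real.log 3) := by
    rw [Real.log_div hx0.ne' (by norm_num), show (6 : ℝ) = 2 * 3 by norm_num,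
      Real.log_mul (by norm_num) (by norm_num)]
  have l7 : Real.log (x / 7) = Real.log x - Real.log 7 := Real.log_div hx0.ne' (by norm_num)
  have l70 : Real.log (x / 70) = Real.log x - (Real.log 2 + Real.log 5 + Real.log 7) := by
    rw [Real.log_div hx0.ne' (by norm_num), show (70 : ℝ) = 2 * 5 * 7 by norm_num,
      Real.log_mul (by norm_num) (by norm_num), Real.log_mul (by norm_num) (by norm_num)]
  have l210 : Real.log (x / 210) =
      Real.log x - (Real.log 2 + Real.log 3 + Real.log 5 + Real.log 7) := by
    rw [Real.log_div hx0.ne' (by norm_num), show (210 : ℝ) = 2 * 3 * 5 * 7 by norm_num,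
      Real.log_mul (by norm_num) (by norm_num), Real.log_mul (by norm_num) (by norm_num),
      Real.log_mul (by norm_num) (by norm_num)]
  have key : (x * Real.log x - x) - (x / 2 * Real.log (x / 2) - x / 2) - (x / 3 * Real.log (x / 3) - x / 3)
      - (x / 5 * Real.log (x / 5) - x / 5) + (x / 6 * Real.log (x / 6) - x / 6)
      - (x / 7 * Real.log (x / 7) - x / 7) + (x / 70 * Real.log (x / 70) - x / 70)
      - (x / 210 * Real.log (x / 210) - x / 210) = A * x := by
    rw [l2, l3, l5, l6, l7, l70, l210, A]; ring
  rw [abs_le] at e1 e2 e3 e5 e6 e7 e70 e210 ⊢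
  rw [V]
  constructor <;> linarith [e1.1, e1.2, e2.1, e2.2, e3.1, e3.2, e5.1, e5.2, e6.1, e6.2, e7.1, e7.2,
    e70.1, e70.2, e210.1, e210.2]

/-! ### Numerical constants -/

/-- `1.9459100 < log 7 < 1.9459103` (`log 7 = 3 log 2 + log(1 − 1/8)`, seven terms of the series).
[folklore] -/
theorem log_seven_bounds : (1.9459100 : ℝ) < Real.log 7 ∧ Real.log 7 < 1.9459103 := by
  have h := Real.abs_log_sub_add_sum_range_le (x := (1 / 8 : ℝ))
    (by rw [abs_of_pos (by norm_num)]; norm_num) 7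
  rw [abs_of_pos (by norm_num : (0 : ℝ) < 1 / 8)] at h
  have hs : ∑ i ∈ range 7, (1 / 8 : ℝ) ^ (i + 1) / (i + 1) = 29403739 / 220200960 := by
    simp only [sum_range_succ, sum_range_zero]
    norm_num
  have h78 : Real.log ((1 : ℝ) - 1 / 8) = Real.log 7 - 3 * Real.log 2 := by
    rw [show (1 : ℝ) - 1 / 8 = 7 / 2 ^ 3 by norm_num, Real.log_div (by norm_num) (by norm_num),
      Real.log_pow]; push_cast; ring
  rw [hs, h78] at h
  have h2 := Real.log_two_gt_d9
  have h2' := Real.log_two_lt_d9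
  have h' := abs_le.1 h
  norm_num at h'
  constructor <;> linarith [h'.1, h'.2]

/-- `0.97879 ≤ A ≤ 0.97880`. [cite: Gantumur2025, §4 (`A(ν₆) = 0.9787…`)] -/
theorem A_bounds : (0.97879 : ℝ) ≤ A ∧ A ≤ 0.97880 := by
  have h2 := Real.log_two_gt_d9
  have h2' := Real.log_two_lt_d9
  have h3 := Real.log_three_gt_d9
  have h3' := Real.log_three_lt_d9
  have h5 := Real.log_five_gt_d9
  have h5' := Real.log_five_lt_d9
  have h7 := log_seven_bounds
  rw [A]
  constructor <;> linarith [h7.1, h7.2]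

/-! ### Auxiliary numerical lemmas -/

/-- `√(x/r) ≤ c √x` as soon as `c² r ≥ 1`. [folklore] -/
theorem sqrt_div_le {x r c : ℝ} (hx : 0 ≤ x) (hr : 0 < r) (hc : 0 ≤ c) (h : 1 ≤ c ^ 2 * r) :
    Real.sqrt (x / r) ≤ c * Real.sqrt x := by
  have e : c * Real.sqrt x = Real.sqrt (c ^ 2 * x) := by
    rw [Real.sqrt_mul (sq_nonneg c), Real.sqrt_sq hc]
  rw [e]
  apply Real.sqrt_le_sqrt
  rw [div_le_iff₀ hr]
  nlinarith

/-- `log x ≤ 14 + x / 3200000` (tangent line of `log` at `e¹⁵ > 3.2 · 10⁶`). [folklore] -/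
theorem log_le_linear {x : ℝ} (hx : 0 < x) : Real.log x ≤ 14 + x / 3200000 := by
  have h15 : (3200000 : ℝ) ≤ Real.exp 15 := by
    have h1 : Real.exp 15 = Real.exp 1 ^ 15 := by rw [← Real.exp_nat_mul]; norm_num
    rw [h1]
    have h2 := Real.exp_one_gt_d9
    calc (3200000 : ℝ) ≤ 2.7182818283 ^ 15 := by norm_num
      _ ≤ Real.exp 1 ^ 15 := pow_le_pow_left₀ (by norm_num) h2.le 15
  have hpos : 0 < Real.exp 15 := Real.exp_pos 15
  have hlog : Real.log (x / Real.exp 15) ≤ x / Real.exp 15 - 1 :=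
    Real.log_le_sub_one_of_pos (by positivity)
  rw [Real.log_div hx.ne' hpos.ne', Real.log_exp] at hlog
  have : x / Real.exp 15 ≤ x / 3200000 := div_le_div_of_nonneg_left hx.le (by norm_num) h15
  linarith

/-- `log x ≤ 16.001` for `0 < x ≤ 8886113` (`e¹⁶·⁰⁰¹ > 8886113`). [folklore] -/
theorem log_le_of_le_Xb {x : ℝ} (hx : 0 < x) (hx' : x ≤ 8886113) : Real.log x ≤ 16.001 := by
  have h : (8886113 : ℝ) ≤ Real.exp 16.001 := by
    have h1 : Real.exp 16.001 = Real.exp 1 ^ 16 * Real.exp 0.001 := by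
      rw [← Real.exp_nat_mul, ← Real.exp_add]; norm_num
    rw [h1]
    have h2 := Real.exp_one_gt_d9
    have h3 : (0.001 : ℝ) + 1 ≤ Real.exp 0.001 := Real.add_one_le_exp _
    have h4 : (2.7182818283 : ℝ) ^ 16 ≤ Real.exp 1 ^ 16 := pow_le_pow_left₀ (by norm_num) h2.le 16
    calc (8886113 : ℝ) ≤ 2.7182818283 ^ 16 * (0.001 + 1) := by norm_num
      _ ≤ Real.exp 1 ^ 16 * Real.exp 0.001 :=
          mul_le_mul h4 h3 (by norm_num) (pow_nonneg (Real.exp_pos 1).le 16)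
  calc Real.log x ≤ Real.log 8886113 := Real.log_le_log hx hx'
    _ ≤ Real.log (Real.exp 16.001) := Real.log_le_log (by norm_num) h
    _ = 16.001 := Real.log_exp _

/-- Schoenfeld's error `√x log² x/(8π)` is at most `10.25 √x` on `1 ≤ x ≤ 8886113`. [folklore] -/
theorem schoenfeld_err_le {x : ℝ} (hx : 1 ≤ x) (hx' : x ≤ 8886113) :
    Real.sqrt x * Real.log x ^ 2 / (8 * Real.pi) ≤ 10.25 * Real.sqrt x := by
  have hlog := log_le_of_le_Xb (by linarith) hx'
  have hlog0 : 0 ≤ Real.log x := Real.log_nonneg hx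
  have hpi := Real.pi_gt_d2
  rw [div_le_iff₀ (by positivity)]
  have hsq : Real.log x ^ 2 ≤ 10.25 * (8 * Real.pi) := by nlinarith
  have hs0 : 0 ≤ Real.sqrt x := Real.sqrt_nonneg x
  calc Real.sqrt x * Real.log x ^ 2 ≤ Real.sqrt x * (10.25 * (8 * Real.pi)) :=
        mul_le_mul_of_nonneg_left hsq hs0
    _ = 10.25 * Real.sqrt x * (8 * Real.pi) := by ring

/-! ### Base range `0 ≤ x < 8886113` (kernel-certified tables of the tree) -/

/-- Upper bound on the base range: `ψ(x) ≤ 1.0722 x + 7 √x` for `0 ≤ x ≤ 8886113`, from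
`ψ ≤ 1.04 x` (`x ≤ 10⁴`), Schoenfeld's `|θ(x) − x| ≤ √x log²x/(8π)` on `[599, 8886113]` and Nicolas's
`ψ − θ ≤ √x + (4/3) x^{1/3}` below `2³²`, all certified by kernel computation in the tree. [folklore] -/
theorem base_upper {x : ℝ} (hx0 : 0 ≤ x) (hx : x ≤ 8886113) : ψ x ≤ 1.0722 * x + 7 * Real.sqrt x := by
  have hs0 : 0 ≤ Real.sqrt x := Real.sqrt_nonneg x
  rcases le_or_gt x 10000 with h4 | h4
  · have := SchoenfeldBound.psi_le_of_le_ten_thousand hx0 h4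
    nlinarith
  · have hx1 : 1 ≤ x := by linarith
    have hθ := abs_theta_sub_le_smallRange (by linarith) hx
    have hE := psi_sub_theta_le_of_lt_two_pow_32 hx1 (by norm_num; linarith)
    have herr := schoenfeld_err_le hx1 hx
    have hcube : x ^ ((1 : ℝ) / 3) ≤ Real.sqrt x := by
      rw [Real.sqrt_eq_rpow]
      exact Real.rpow_le_rpow_of_exponent_le hx1 (by norm_num)
    have hsq : 100 ≤ Real.sqrt x := by
      rw [show (100 : ℝ) = Real.sqrt (100 ^ 2) by rw [Real.sqrt_sq (by norm_num)]]
      exact Real.sqrt_le_sqrt (by linarith)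
    have hxx : Real.sqrt x * Real.sqrt x = x := Real.mul_self_sqrt hx0
    have hθ' := (abs_le.1 hθ).2
    nlinarith

/-- Lower bound on the base range: `0.9392 x − 9 √x ≤ ψ(x)` for `0 ≤ x ≤ 8886113`, from
Mathlib's `ψ(x) ≥ (x−1) log 2 − log(x+2)` below `599` and Schoenfeld's certified `θ`-bound above.
[folklore] -/
theorem base_lower {x : ℝ} (hx0 : 0 ≤ x) (hx : x ≤ 8886113) : 0.9392 * x - 9 * Real.sqrt x ≤ ψ x := by
  have hs0 : 0 ≤ Real.sqrt x := Real.sqrt_nonneg x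
  have hxx : Real.sqrt x * Real.sqrt x = x := Real.mul_self_sqrt hx0
  have hψ0 := Chebyshev.psi_nonneg x
  rcases lt_or_ge x 2 with h2 | h2
  · -- trivial: the left side is `≤ 0`
    have hsx : Real.sqrt x ≤ 1.5 := by
      calc Real.sqrt x ≤ Real.sqrt (1.5 ^ 2) := Real.sqrt_le_sqrt (by nlinarith)
        _ = 1.5 := Real.sqrt_sq (by norm_num)
    nlinarith
  rcases le_or_gt x 599 with h599 | h599
  · -- `2 ≤ x ≤ 599`: Chebyshev's elementary lower bound
    have hge := Chebyshev.psi_ge' hx0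
    have hl2 := Real.log_two_gt_d9
    have hl2' := Real.log_two_lt_d9
    have hlog : Real.log (x + 2) ≤ 6.932 := by
      calc Real.log (x + 2) ≤ Real.log (2 ^ 10) := Real.log_le_log (by linarith) (by norm_num; linarith)
        _ = 10 * Real.log 2 := by rw [Real.log_pow]; norm_num
        _ ≤ 6.932 := by linarith
    have hsx2 : Real.sqrt 2 ≤ Real.sqrt x := Real.sqrt_le_sqrt h2
    have hs2 : (1.41 : ℝ) ≤ Real.sqrt 2 := by
      rw [show (1.41 : ℝ) = Real.sqrt (1.41 ^ 2) by rw [Real.sqrt_sq (by norm_num)]]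
      exact Real.sqrt_le_sqrt (by norm_num)
    have hsx599 : Real.sqrt x ≤ 24.48 := by
      calc Real.sqrt x ≤ Real.sqrt (24.48 ^ 2) := Real.sqrt_le_sqrt (by nlinarith)
        _ = 24.48 := Real.sqrt_sq (by norm_num)
    -- `x = √x · √x ≤ 24.48 √x`
    have hxle : x ≤ 24.48 * Real.sqrt x := by nlinarith
    nlinarith
  · -- `599 < x ≤ 8886113`: Schoenfeld's certified bound
    have hx1 : 1 ≤ x := by linarith
    have hθ := abs_theta_sub_le_smallRange h599.le hx
    have herr := schoenfeld_err_le hx1 hx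
    have hθψ := Chebyshev.theta_le_psi x
    have hsq : 24 ≤ Real.sqrt x := by
      rw [show (24 : ℝ) = Real.sqrt (24 ^ 2) by rw [Real.sqrt_sq (by norm_num)]]
      exact Real.sqrt_le_sqrt (by nlinarith)
    have hθ' := (abs_le.1 hθ).1
    nlinarith

/-! ### The induction step (`x ≥ 8886113`) -/

/-- **Sylvester's upper recursion**: if the bounds hold on `[0, x/10]` then
`ψ(x) ≤ V(x) + ψ(x/10) − ψ(x/11) + ψ(x/15) ≤ 1.0722 x + 7 √x`. [cite: Gantumur2025, §6 (iteration for ν₆)] -/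
theorem step_upper {x : ℝ} (hx : 8886113 ≤ x)
    (IH : ∀ y : ℝ, 0 ≤ y → y ≤ x / 10 →
      0.9392 * y - 9 * Real.sqrt y ≤ ψ y ∧ ψ y ≤ 1.0722 * y + 7 * Real.sqrt y) :
    ψ x ≤ 1.0722 * x + 7 * Real.sqrt x := by
  have hx0 : 0 < x := by linarith
  have hcomb := psi_comb_le_V x
  have hV := (abs_le.1 (abs_V_sub_le (x := x) (by linarith))).2
  have hA := A_bounds.2
  have hlog := log_le_linear hx0
  have h10 := (IH (x / 10) (by positivity) le_rfl).2
  have h11 := (IH (x / 11) (by positivity) (by rw [div_le_div_iff_of_pos_left hx0 (by norm_num) (by norm_num)]; norm_num)).1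
  have h15 := (IH (x / 15) (by positivity) (by rw [div_le_div_iff_of_pos_left hx0 (by norm_num) (by norm_num)]; norm_num)).2
  have s10 := sqrt_div_le hx0.le (by norm_num : (0 : ℝ) < 10) (by norm_num : (0 : ℝ) ≤ 0.3163) (by norm_num)
  have s11 := sqrt_div_le hx0.le (by norm_num : (0 : ℝ) < 11) (by norm_num : (0 : ℝ) ≤ 0.3016) (by norm_num)
  have s15 := sqrt_div_le hx0.le (by norm_num : (0 : ℝ) < 15) (by norm_num : (0 : ℝ) ≤ 0.2583) (by norm_num)
  have hs0 : 0 ≤ Real.sqrt x := Real.sqrt_nonneg x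
  have hsq : 2980 ≤ Real.sqrt x := by
    rw [show (2980 : ℝ) = Real.sqrt (2980 ^ 2) by rw [Real.sqrt_sq (by norm_num)]]
    exact Real.sqrt_le_sqrt (by nlinarith)
  nlinarith

/-- **Sylvester's lower recursion**: if the bounds hold on `[0, x/10]` then
`ψ(x) ≥ V(x) − ψ(x/13) + ψ(x/14) − ψ(x/19) + ψ(x/20) − ψ(x/73) ≥ 0.9392 x − 9 √x`.
[cite: Gantumur2025, §6 (iteration for ν₆)] -/
theorem step_lower {x : ℝ} (hx : 8886113 ≤ x)
    (IH : ∀ y : ℝ, 0 ≤ y → y ≤ x / 10 →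
      0.9392 * y - 9 * Real.sqrt y ≤ ψ y ∧ ψ y ≤ 1.0722 * y + 7 * Real.sqrt y) :
    0.9392 * x - 9 * Real.sqrt x ≤ ψ x := by
  have hx0 : 0 < x := by linarith
  have hcomb := V_le_psi_comb x
  have hV := (abs_le.1 (abs_V_sub_le (x := x) (by linarith))).1
  have hA := A_bounds.1
  have hlog := log_le_linear hx0
  have hle : ∀ r : ℝ, 10 ≤ r → x / r ≤ x / 10 := fun r hr =>
    div_le_div_of_nonneg_left hx0.le (by norm_num) hr
  have h13 := (IH (x / 13) (by positivity) (hle 13 (by norm_num))).2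
  have h14 := (IH (x / 14) (by positivity) (hle 14 (by norm_num))).1
  have h19 := (IH (x / 19) (by positivity) (hle 19 (by norm_num))).2
  have h20 := (IH (x / 20) (by positivity) (hle 20 (by norm_num))).1
  have h73 := (IH (x / 73) (by positivity) (hle 73 (by norm_num))).2
  have s13 := sqrt_div_le hx0.le (by norm_num : (0 : ℝ) < 13) (by norm_num : (0 : ℝ) ≤ 0.2774) (by norm_num)
  have s14 := sqrt_div_le hx0.le (by norm_num : (0 : ℝ) < 14) (by norm_num : (0 : ℝ) ≤ 0.2673) (by norm_num)
  have s19 := sqrt_div_le hx0.le (by norm_num : (0 : ℝ) < 19) (by norm_num : (0 : ℝ) ≤ 0.2295) (by norm_num)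
  have s20 := sqrt_div_le hx0.le (by norm_num : (0 : ℝ) < 20) (by norm_num : (0 : ℝ) ≤ 0.2237) (by norm_num)
  have s73 := sqrt_div_le hx0.le (by norm_num : (0 : ℝ) < 73) (by norm_num : (0 : ℝ) ≤ 0.1171) (by norm_num)
  have hs0 : 0 ≤ Real.sqrt x := Real.sqrt_nonneg x
  have hsq : 2980 ≤ Real.sqrt x := by
    rw [show (2980 : ℝ) = Real.sqrt (2980 ^ 2) by rw [Real.sqrt_sq (by norm_num)]]
    exact Real.sqrt_le_sqrt (by nlinarith)
  nlinarith

/-- The two-sided bound by strong induction on `⌊x⌋`. [cite: Gantumur2025, §5–§6] -/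
theorem psi_bounds_of_floor_eq (n : ℕ) : ∀ x : ℝ, 0 ≤ x → ⌊x⌋₊ = n →
    0.9392 * x - 9 * Real.sqrt x ≤ ψ x ∧ ψ x ≤ 1.0722 * x + 7 * Real.sqrt x := by
  induction n using Nat.strong_induction_on with
  | _ n IH =>
    intro x hx0 hn
    rcases le_or_gt x 8886113 with hx | hx
    · exact ⟨base_lower hx0 hx, base_upper hx0 hx⟩
    · have IH' : ∀ y : ℝ, 0 ≤ y → y ≤ x / 10 →
          0.9392 * y - 9 * Real.sqrt y ≤ ψ y ∧ ψ y ≤ 1.0722 * y + 7 * Real.sqrt y := by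
        intro y hy0 hy
        refine IH ⌊y⌋₊ ?_ y hy0 rfl
        rw [← hn]
        have h1 : (⌊y⌋₊ : ℝ) ≤ y := Nat.floor_le hy0
        have h2 : x < ⌊x⌋₊ + 1 := Nat.lt_floor_add_one x
        have h3 : (⌊y⌋₊ : ℝ) < ⌊x⌋₊ := by linarith
        exact_mod_cast h3
      exact ⟨step_lower hx.le IH', step_upper hx.le IH'⟩

end Sylvester

open scoped Chebyshev

/-- **Explicit Chebyshev–Sylvester upper bound: `ψ(x) ≤ 1.0722 x + 7 √x` for every `x ≥ 0`.**
Sylvester's scheme `ν₆ = [1,6,70;2,3,5,7,210]` with his iterative refinement (fixed point of the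
reduced recursion `b = A + b/10 − a/11 + b/15`, `a = A − b/13 + a/14 − b/19 + a/20 − b/73`,
`A = A(ν₆) = 0.97879…`; the full recursion gives `1.05580`, Gantumur §6, but only with error terms
`x^{0.8+}`). [cite: Sylvester1892, pp. 87–120 (scheme [1,6,70;2,3,5,7,210])] -/
theorem psi_le_sylvester {x : ℝ} (hx : 0 ≤ x) : ψ x ≤ 1.0722 * x + 7 * Real.sqrt x :=
  (Sylvester.psi_bounds_of_floor_eq ⌊x⌋₊ x hx rfl).2

/-- **Explicit Chebyshev–Sylvester lower bound: `0.9392 x − 9 √x ≤ ψ(x)` for every `x ≥ 0`.**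
[cite: Sylvester1892, pp. 87–120 (scheme [1,6,70;2,3,5,7,210])] -/
theorem sylvester_le_psi {x : ℝ} (hx : 0 ≤ x) : 0.9392 * x - 9 * Real.sqrt x ≤ ψ x :=
  (Sylvester.psi_bounds_of_floor_eq ⌊x⌋₊ x hx rfl).1

/-- **Corollary for `θ`: `0.9392 x − 9 √x − 2 √x log x ≤ θ(x) ≤ 1.0722 x + 7 √x` for `x ≥ 1`.**
[cite: Sylvester1892, pp. 87–120 (scheme [1,6,70;2,3,5,7,210])] -/
theorem theta_bounds_sylvester {x : ℝ} (hx : 1 ≤ x) :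
    0.9392 * x - 9 * Real.sqrt x - 2 * Real.sqrt x * Real.log x ≤ θ x ∧
      θ x ≤ 1.0722 * x + 7 * Real.sqrt x := by
  have h1 := sylvester_le_psi (x := x) (by linarith)
  have h2 := psi_le_sylvester (x := x) (by linarith)
  have h3 := Chebyshev.psi_sub_theta_le hx
  have h4 := Chebyshev.theta_le_psi x
  constructor <;> linarith

end Literature.NumberTheory.LFunctions
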